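import Summits.CriticalPhenomena.PercolationContinuityZ3.Theorems.PercNearOneGluingNoHeavyLowerTailSahiOneStepCone
import HarnessLib

/-!
# One-step scheme: the AVERAGING COMPRESSION at an arbitrary density vector, part 1/3 — weights, values, range, monotonicity

Support file (prover prim-ineq-prove-3 gen 30; `--supports stmt-CriticalPhenomena-4575`; memo
`run/shared/lean/prim/prim-ineq-prove-3/PROOF-G30-SHIFTED-PARTNER.md` §2).  No definitions, no named facts, no sorries, no `native_decide`.

For `p ∈ (0,1)^ι` and coordinates `i ≠ j`, the averaging compression `A f` of `f : Set ι → ℝ` (no definition is introduced: the mean `m` and the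
operator `A` are section hypotheses `hm`, `hA` fixing their formulae, discharged by `rfl` in the definition-free package `exists_avgC_shape`) replaces, on every pair `(S+i, S+j)`
with `f(S+i) < f(S+j)`, both values by their product-weight mean.  Here: the weight of a trade (`bernoulliWeight_trade`: `w(ω)qᵢpⱼ = w(ω−i+j)pᵢqⱼ`),
the values on/off pairs (`avgC_pair`, `avgC_of_not`), the range `[0,1]` (`avgC_mem_Icc`), **monotonicity on the cube is preserved**
(`avgC_monotone`, the case analysis of the memo), and `F`-determinedness is preserved (`avgC_determined`).  Parts 2/3, 3/3:
`…FuzzyCompressionSums` (pair sums, balance, energy), `…FuzzyCompression` (the minimiser ⇒ FUZZY COMPRESSION LEMMA).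
-/

noncomputable section

namespace Summit.CriticalPhenomena.PercolationContinuityZ3.Theorems

namespace SahiOneStep

open Literature.Combinatorics.Sahi2008
open Literature.Probability.Percolation (DeterminedBy determinedBy_iff)
open Literature.Probability.Percolation.DecisionTree (ind ind_of_mem ind_of_not_mem ind_nonneg)
open Literature.Probability.Percolation.BHK2006 (weight weight_nonneg)
open Literature.Probability.LatticeModels (prodBernoulli)
open SahiCdd (ex_congr' ex_lin2)
open scoped Classical

variable {ι : Type*} [Fintype ι]
/-! ## §1 The product weight under a trade -/

omit [Fintype ι] in
/-- Membership in a trade. [folklore] -/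
theorem mem_trade_iff {i j : ι} {ω : Set ι} {e : ι} : e ∈ (ω \ {i}) ∪ {j} ↔ (e ∈ ω ∧ e ≠ i) ∨ e = j := by
  simp only [Set.mem_union, Set.mem_sdiff, Set.mem_singleton_iff]

omit [Fintype ι] in
/-- Trading `i ∈ ω` for `j ∉ ω` and back. [folklore] -/
theorem trade_trade {i j : ι} (_hij : i ≠ j) {ω : Set ι} (hi : i ∈ ω) (hj : j ∉ ω) :
    (((ω \ {i}) ∪ {j}) \ {j}) ∪ {i} = ω := by
  ext e
  simp only [mem_trade_iff]
  constructor
  · intro h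
    rcases h with ⟨h1, hne'⟩ | h2
    · rcases h1 with ⟨he, _⟩ | h3
      · exact he
      · exact absurd h3 hne'
    · rw [h2]; exact hi
  · intro he
    by_cases hei : e = i
    · exact Or.inr hei
    · exact Or.inl ⟨Or.inl ⟨he, hei⟩, fun hej => hj (hej ▸ he)⟩

/-- The product weight is positive at an interior density vector. [folklore] -/
theorem bernoulliWeight_pos (p : ι → unitInterval) (hp : ∀ e, 0 < (p e : ℝ) ∧ (p e : ℝ) < 1) (ω : Set ι) :
    0 < bernoulliWeight p ω := by
  unfold bernoulliWeight weight
  refine Finset.prod_pos fun e _ => ?_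
  split_ifs
  · exact (hp e).1
  · exact sub_pos.2 (hp e).2

/-- Weights of two configurations that agree off `{i,j}`, with `i ∈ ω ∌ j` and `j ∈ η ∌ i`: `w(ω)·qᵢpⱼ = w(η)·pᵢqⱼ`. [folklore] -/
theorem bernoulliWeight_agree_off (p : ι → unitInterval) {i j : ι} (hij : i ≠ j) {ω η : Set ι}
    (hagree : ∀ e, e ≠ i → e ≠ j → (e ∈ η ↔ e ∈ ω)) (hi : i ∈ ω) (hj : j ∉ ω) (hi' : i ∉ η) (hj' : j ∈ η) :
    bernoulliWeight p ω * ((1 - (p i : ℝ)) * (p j : ℝ)) = bernoulliWeight p η * ((p i : ℝ) * (1 - (p j : ℝ))) := by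
  have hiu : i ∈ (Finset.univ : Finset ι) := Finset.mem_univ i
  have hju : j ∈ (Finset.univ : Finset ι).erase i := Finset.mem_erase.2 ⟨hij.symm, Finset.mem_univ j⟩
  have key : ∀ θ : Set ι, bernoulliWeight p θ = (if i ∈ θ then (p i : ℝ) else 1 - (p i : ℝ)) *
      ((if j ∈ θ then (p j : ℝ) else 1 - (p j : ℝ)) *
        ∏ e ∈ ((Finset.univ : Finset ι).erase i).erase j, (if e ∈ θ then (p e : ℝ) else 1 - (p e : ℝ))) := by
    intro θ
    unfold bernoulliWeight weight
    rw [← Finset.mul_prod_erase _ _ hiu, ← Finset.mul_prod_erase _ _ hju]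
  have hrest : ∏ e ∈ ((Finset.univ : Finset ι).erase i).erase j, (if e ∈ η then (p e : ℝ) else 1 - (p e : ℝ)) =
      ∏ e ∈ ((Finset.univ : Finset ι).erase i).erase j, (if e ∈ ω then (p e : ℝ) else 1 - (p e : ℝ)) := by
    refine Finset.prod_congr rfl fun e he => ?_
    have hej : e ≠ j := (Finset.mem_erase.1 he).1
    have hei : e ≠ i := (Finset.mem_erase.1 (Finset.mem_erase.1 he).2).1
    simp only [hagree e hei hej]
  rw [key ω, key η, hrest, if_pos hi, if_neg hj, if_neg hi', if_pos hj']
  ring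

/-- **Weight of a trade**: `w(ω)·qᵢ·pⱼ = w(ω − i + j)·pᵢ·qⱼ` for `i ∈ ω`, `j ∉ ω`. [folklore] -/
theorem bernoulliWeight_trade (p : ι → unitInterval) {i j : ι} (hij : i ≠ j) {ω : Set ι} (hi : i ∈ ω) (hj : j ∉ ω) :
    bernoulliWeight p ω * ((1 - (p i : ℝ)) * (p j : ℝ)) =
      bernoulliWeight p ((ω \ {i}) ∪ {j}) * ((p i : ℝ) * (1 - (p j : ℝ))) := by
  refine bernoulliWeight_agree_off p hij (fun e hei hej => ?_) hi hj ?_ (Or.inr rfl)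
  · simp only [Set.mem_union, Set.mem_sdiff, Set.mem_singleton_iff]
    constructor
    · rintro (⟨h, _⟩ | h)
      · exact h
      · exact absurd h hej
    · intro h; exact Or.inl ⟨h, hei⟩
  · intro h
    rcases h with ⟨_, hii⟩ | h'
    · exact hii rfl
    · exact hij h'

/-! ## §2 The averaging compression -/

section avg
variable (p : ι → unitInterval) (hp : ∀ e, 0 < (p e : ℝ) ∧ (p e : ℝ) < 1) (i j : ι)
/- the weighted mean `m u v = (pᵢqⱼu + qᵢpⱼv)/(pᵢqⱼ + qᵢpⱼ)` and the averaging compression `A f` (`(max(u,m), min(v,m))` on each pair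
`(S+i, S+j)`, `f` elsewhere), as hypotheses fixing their formulae (no definitions) -/
variable (m : ℝ → ℝ → ℝ)
  (hm : ∀ u v, m u v = ((p i : ℝ) * (1 - (p j : ℝ)) * u + (1 - (p i : ℝ)) * (p j : ℝ) * v) / ((p i : ℝ) * (1 - (p j : ℝ)) + (1 - (p i : ℝ)) * (p j : ℝ)))
  (A : (Set ι → ℝ) → Set ι → ℝ)
  (hA : ∀ (f : Set ι → ℝ) (ω : Set ι), A f ω =
    if i ∈ ω ∧ j ∉ ω then max (f ω) (m (f ω) (f ((ω \ {i}) ∪ {j})))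
    else if j ∈ ω ∧ i ∉ ω then min (f ω) (m (f ((ω \ {j}) ∪ {i})) (f ω)) else f ω)
include hp hm hA

omit [Fintype ι] hm hA in
/-- The two weight coefficients are positive. [folklore] -/
theorem coef_pos : 0 < (p i : ℝ) * (1 - (p j : ℝ)) ∧ 0 < (1 - (p i : ℝ)) * (p j : ℝ) :=
  ⟨mul_pos (hp i).1 (sub_pos.2 (hp j).2), mul_pos (sub_pos.2 (hp i).2) (hp j).1⟩

omit [Fintype ι] hA in
/-- The weighted mean lies between its arguments. [folklore] -/
theorem wavg_mem (u v : ℝ) : min u v ≤ m u v ∧ m u v ≤ max u v := by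
  obtain ⟨ha, hb⟩ := coef_pos p hp i j
  rw [hm]
  set a := (p i : ℝ) * (1 - (p j : ℝ)); set b := (1 - (p i : ℝ)) * (p j : ℝ)
  have hab : 0 < a + b := add_pos ha hb
  constructor
  · rw [le_div_iff₀ hab]
    nlinarith [min_le_left u v, min_le_right u v]
  · rw [div_le_iff₀ hab]
    nlinarith [le_max_left u v, le_max_right u v]

omit [Fintype ι] hA in
/-- The weighted mean is monotone in both arguments. [folklore] -/
theorem wavg_mono {u v u' v' : ℝ} (hu : u ≤ u') (hv : v ≤ v') : m u v ≤ m u' v' := by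
  obtain ⟨ha, hb⟩ := coef_pos p hp i j
  have hab : 0 < (p i : ℝ) * (1 - (p j : ℝ)) + (1 - (p i : ℝ)) * (p j : ℝ) := add_pos ha hb
  rw [hm, hm, div_le_div_iff_of_pos_right hab]
  nlinarith

omit [Fintype ι] hp hm in
/-- **Values.**  On a pair `(S+i, S+j)` (`i ≠ j`, `i, j ∉ S`) the compression takes the values `(max(u,m), min(v,m))`, `m` the weighted mean of
`u = f(S+i)`, `v = f(S+j)`; elsewhere it is `f`. [this work] -/
theorem avgC_pair (hij : i ≠ j) (f : Set ι → ℝ) {ω : Set ι} (hi : i ∈ ω) (hj : j ∉ ω) :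
    A f ω = max (f ω) (m (f ω) (f ((ω \ {i}) ∪ {j}))) ∧
    A f ((ω \ {i}) ∪ {j}) = min (f ((ω \ {i}) ∪ {j})) (m (f ω) (f ((ω \ {i}) ∪ {j}))) := by
  constructor
  · rw [hA, if_pos (show i ∈ ω ∧ j ∉ ω from ⟨hi, hj⟩)]
  · have h1 : ¬ (i ∈ (ω \ {i}) ∪ {j} ∧ j ∉ (ω \ {i}) ∪ {j}) := fun h => h.2 (Or.inr rfl)
    have h2 : j ∈ (ω \ {i}) ∪ {j} ∧ i ∉ (ω \ {i}) ∪ {j} := by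
      refine ⟨Or.inr rfl, ?_⟩
      intro h
      rcases h with ⟨_, hii⟩ | h'
      · exact hii rfl
      · exact hij h'
    rw [hA, if_neg h1, if_pos h2]
    have ht : ((ω \ {i}) ∪ {j}) \ {j} ∪ {i} = ω := trade_trade hij hi hj
    rw [ht]

omit [Fintype ι] hp hm in
/-- Off the pairs the compression is the identity. [this work] -/
theorem avgC_of_not {f : Set ι → ℝ} {ω : Set ι} (h1 : ¬ (i ∈ ω ∧ j ∉ ω)) (h2 : ¬ (j ∈ ω ∧ i ∉ ω)) : A f ω = f ω := by
  rw [hA, if_neg h1, if_neg h2]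

omit [Fintype ι] in
/-- **Range.** `[0,1]`-valued functions stay `[0,1]`-valued. [this work] -/
theorem avgC_mem_Icc {f : Set ι → ℝ} (hf : ∀ ω, 0 ≤ f ω ∧ f ω ≤ 1) (ω : Set ι) : 0 ≤ A f ω ∧ A f ω ≤ 1 := by
  rw [hA]
  split_ifs with h1 h2
  · have hm := wavg_mem p hp i j m hm (f ω) (f ((ω \ {i}) ∪ {j}))
    constructor
    · exact (hf ω).1.trans (le_max_left _ _)
    · exact max_le (hf ω).2 (hm.2.trans (max_le (hf _).2 (hf _).2))
  · have hm := wavg_mem p hp i j m hm (f ((ω \ {j}) ∪ {i})) (f ω)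
    constructor
    · exact le_min (hf ω).1 (le_trans (le_min (hf _).1 (hf _).1) hm.1)
    · exact (min_le_left _ _).trans (hf ω).2
  · exact hf ω


omit [Fintype ι] hp hm hA in
/-- Partners: `ω − i + j ⊆ η − i + j` when `ω ⊆ η`. [folklore] -/
theorem trade_mono {ω η : Set ι} (h : ω ⊆ η) : (ω \ {i}) ∪ {j} ⊆ (η \ {i}) ∪ {j} :=
  Set.union_subset_union_left _ (Set.sdiff_subset_sdiff_left h)

omit [Fintype ι] in
/-- **Monotonicity is preserved.** [this work] -/
theorem avgC_monotone (hij : i ≠ j) {f : Set ι → ℝ} (hf : Monotone f) : Monotone (A f) := by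
  intro ω η hle
  have hmv := fun u v => wavg_mem p hp i j m hm u v
  by_cases hPω : i ∈ ω ∧ j ∉ ω
  · -- ω = S + i
    have hiη : i ∈ η := hle hPω.1
    rw [(avgC_pair i j m A hA hij f hPω.1 hPω.2).1]
    by_cases hjη : j ∈ η
    · -- η contains both: value f η
      rw [avgC_of_not i j m A hA (f := f) (fun h => h.2 hjη) (fun h => h.2 hiη)]
      refine max_le (hf hle) ((hmv _ _).2.trans (max_le (hf hle) (hf ?_)))
      rintro e (⟨he, _⟩ | rfl)
      · exact hle he
      · exact hjη
    · rw [(avgC_pair i j m A hA hij f hiη hjη).1]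
      exact max_le_max (hf hle) (wavg_mono p hp i j m hm (hf hle) (hf (trade_mono i j hle)))
  · by_cases hQω : j ∈ ω ∧ i ∉ ω
    · -- ω = S + j
      have hjη : j ∈ η := hle hQω.1
      have hωeq : ((ω \ {j}) ∪ {i}) \ {i} ∪ {j} = ω := trade_trade hij.symm hQω.1 hQω.2
      have hω' : i ∈ (ω \ {j}) ∪ {i} ∧ j ∉ (ω \ {j}) ∪ {i} := by
        refine ⟨Or.inr rfl, ?_⟩
        intro h
        rcases h with ⟨_, hjj⟩ | h'
        · exact hjj rfl
        · exact hij.symm h'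
      have hvω := (avgC_pair i j m A hA hij f hω'.1 hω'.2).2
      rw [hωeq] at hvω
      rw [hvω]
      by_cases hiη : i ∈ η
      · rw [avgC_of_not i j m A hA (f := f) (fun h => h.2 hjη) (fun h => h.2 hiη)]
        exact (min_le_left _ _).trans (hf hle)
      · have hηeq : ((η \ {j}) ∪ {i}) \ {i} ∪ {j} = η := trade_trade hij.symm hjη hiη
        have hη' : i ∈ (η \ {j}) ∪ {i} ∧ j ∉ (η \ {j}) ∪ {i} := by
          refine ⟨Or.inr rfl, ?_⟩
          intro h
          rcases h with ⟨_, hjj⟩ | h'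
          · exact hjj rfl
          · exact hij.symm h'
        have hvη := (avgC_pair i j m A hA hij f hη'.1 hη'.2).2
        rw [hηeq] at hvη
        rw [hvη]
        have hsub : (ω \ {j}) ∪ {i} ⊆ (η \ {j}) ∪ {i} := Set.union_subset_union_left _ (Set.sdiff_subset_sdiff_left hle)
        exact min_le_min (hf hle) (wavg_mono p hp i j m hm (hf hsub) (hf hle))
    · -- ω contains both or neither: value f ω
      rw [avgC_of_not i j m A hA (f := f) hPω hQω]
      by_cases hPη : i ∈ η ∧ j ∉ η
      · rw [(avgC_pair i j m A hA hij f hPη.1 hPη.2).1]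
        exact (hf hle).trans (le_max_left _ _)
      · by_cases hQη : j ∈ η ∧ i ∉ η
        · have hηeq : ((η \ {j}) ∪ {i}) \ {i} ∪ {j} = η := trade_trade hij.symm hQη.1 hQη.2
          have hη' : i ∈ (η \ {j}) ∪ {i} ∧ j ∉ (η \ {j}) ∪ {i} := by
            refine ⟨Or.inr rfl, ?_⟩
            intro h
            rcases h with ⟨_, hjj⟩ | h'
            · exact hjj rfl
            · exact hij.symm h'
          have hvη := (avgC_pair i j m A hA hij f hη'.1 hη'.2).2
          rw [hηeq] at hvη
          rw [hvη]
          -- `j ∉ ω` (else `j ∈ ω ⊆ η` and `i ∉ η ⊇ ω` would make `ω` of type `Q`), so `ω ⊆ η − j + i`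
          have hjω : j ∉ ω := fun hjω => hQω ⟨hjω, fun hiω => hQη.2 (hle hiω)⟩
          have hsub : ω ⊆ (η \ {j}) ∪ {i} := fun e he => Or.inl ⟨hle he, fun hej => hjω (hej ▸ he)⟩
          exact le_min (hf hle) (le_trans (le_min (hf hsub) (hf hle)) (hmv _ _).1)
        · rw [avgC_of_not i j m A hA (f := f) hPη hQη]
          exact hf hle

omit [Fintype ι] hp hm in
/-- **`F`-determinedness is preserved** (`i, j ∈ F`). [this work] -/
theorem avgC_determined {F : Finset ι} (hi : i ∈ F) (hj : j ∈ F) {f : Set ι → ℝ} (hf : ∀ ω, f ω = f (ω ∩ (F : Set ι))) :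
    ∀ ω, A f ω = A f (ω ∩ (F : Set ι)) := by
  intro ω
  have hiF : i ∈ ω ∩ (F : Set ι) ↔ i ∈ ω := ⟨fun h => h.1, fun h => ⟨h, hi⟩⟩
  have hjF : j ∈ ω ∩ (F : Set ι) ↔ j ∈ ω := ⟨fun h => h.1, fun h => ⟨h, hj⟩⟩
  have ht1 : ((ω \ {i}) ∪ {j}) ∩ (F : Set ι) = ((ω ∩ (F : Set ι)) \ {i}) ∪ {j} := by
    ext e
    simp only [Set.mem_inter_iff, Set.mem_union, Set.mem_sdiff, Set.mem_singleton_iff, Finset.mem_coe]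
    constructor
    · rintro ⟨(⟨he, hne⟩ | rfl), heF⟩
      · exact Or.inl ⟨⟨he, heF⟩, hne⟩
      · exact Or.inr rfl
    · rintro (⟨⟨he, heF⟩, hne⟩ | rfl)
      · exact ⟨Or.inl ⟨he, hne⟩, heF⟩
      · exact ⟨Or.inr rfl, hj⟩
  have ht2 : ((ω \ {j}) ∪ {i}) ∩ (F : Set ι) = ((ω ∩ (F : Set ι)) \ {j}) ∪ {i} := by
    ext e
    simp only [Set.mem_inter_iff, Set.mem_union, Set.mem_sdiff, Set.mem_singleton_iff, Finset.mem_coe]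
    constructor
    · rintro ⟨(⟨he, hne⟩ | rfl), heF⟩
      · exact Or.inl ⟨⟨he, heF⟩, hne⟩
      · exact Or.inr rfl
    · rintro (⟨⟨he, heF⟩, hne⟩ | rfl)
      · exact ⟨Or.inl ⟨he, hne⟩, heF⟩
      · exact ⟨Or.inr rfl, hi⟩
  rw [hA, hA]
  simp only [hiF, hjF]
  rw [hf ω, hf ((ω \ {i}) ∪ {j}), hf ((ω \ {j}) ∪ {i}), ht1, ht2]

end avg

omit [Fintype ι] in
/-- **The averaging compression, definition-free package (shape).**  For `p ∈ (0,1)^ι`, `i ≠ j` and any `f` there is `g` (the averaging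
compression of `f` towards `i`) with: the pair values `(max(u,m), min(v,m))`, `m = (pᵢqⱼu + qᵢpⱼv)/(pᵢqⱼ + qᵢpⱼ)`; `g = f` off the pairs;
monotonicity, the range `[0,1]` and `F`-determinedness (`i, j ∈ F`) inherited from `f`. [this work] -/
theorem exists_avgC_shape (p : ι → unitInterval) (hp : ∀ e, 0 < (p e : ℝ) ∧ (p e : ℝ) < 1) (i j : ι) (hij : i ≠ j) (f : Set ι → ℝ) :
    ∃ g : Set ι → ℝ,
    (∀ ω : Set ι, i ∈ ω → j ∉ ω →
      g ω = max (f ω) (((p i : ℝ) * (1 - (p j : ℝ)) * f ω + (1 - (p i : ℝ)) * (p j : ℝ) * f ((ω \ {i}) ∪ {j})) /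
        ((p i : ℝ) * (1 - (p j : ℝ)) + (1 - (p i : ℝ)) * (p j : ℝ))) ∧
      g ((ω \ {i}) ∪ {j}) = min (f ((ω \ {i}) ∪ {j})) (((p i : ℝ) * (1 - (p j : ℝ)) * f ω + (1 - (p i : ℝ)) * (p j : ℝ) * f ((ω \ {i}) ∪ {j})) /
        ((p i : ℝ) * (1 - (p j : ℝ)) + (1 - (p i : ℝ)) * (p j : ℝ)))) ∧
    (∀ ω : Set ι, ¬ (i ∈ ω ∧ j ∉ ω) → ¬ (j ∈ ω ∧ i ∉ ω) → g ω = f ω) ∧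
    (Monotone f → Monotone g) ∧
    ((∀ ω, 0 ≤ f ω ∧ f ω ≤ 1) → ∀ ω, 0 ≤ g ω ∧ g ω ≤ 1) ∧
    (∀ F : Finset ι, i ∈ F → j ∈ F → (∀ ω, f ω = f (ω ∩ (F : Set ι))) → ∀ ω, g ω = g (ω ∩ (F : Set ι))) := by
  -- the mean and the operator, as local abbreviations
  set M : ℝ → ℝ → ℝ := fun u v => ((p i : ℝ) * (1 - (p j : ℝ)) * u + (1 - (p i : ℝ)) * (p j : ℝ) * v) / ((p i : ℝ) * (1 - (p j : ℝ)) + (1 - (p i : ℝ)) * (p j : ℝ)) with hM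
  have hm : ∀ u v, M u v = ((p i : ℝ) * (1 - (p j : ℝ)) * u + (1 - (p i : ℝ)) * (p j : ℝ) * v) / ((p i : ℝ) * (1 - (p j : ℝ)) + (1 - (p i : ℝ)) * (p j : ℝ)) := fun _ _ => rfl
  have hA : ∀ (f : Set ι → ℝ) (ω : Set ι), (fun (f : Set ι → ℝ) (ω : Set ι) =>
      if i ∈ ω ∧ j ∉ ω then max (f ω) (M (f ω) (f ((ω \ {i}) ∪ {j})))
      else if j ∈ ω ∧ i ∉ ω then min (f ω) (M (f ((ω \ {j}) ∪ {i})) (f ω)) else f ω) f ω =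
      if i ∈ ω ∧ j ∉ ω then max (f ω) (M (f ω) (f ((ω \ {i}) ∪ {j})))
      else if j ∈ ω ∧ i ∉ ω then min (f ω) (M (f ((ω \ {j}) ∪ {i})) (f ω)) else f ω := fun _ _ => rfl
  refine ⟨(fun (f : Set ι → ℝ) (ω : Set ι) =>
      if i ∈ ω ∧ j ∉ ω then max (f ω) (M (f ω) (f ((ω \ {i}) ∪ {j})))
      else if j ∈ ω ∧ i ∉ ω then min (f ω) (M (f ((ω \ {j}) ∪ {i})) (f ω)) else f ω) f, ?_, ?_, ?_, ?_, ?_⟩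
  · intro ω hi hj
    have h := avgC_pair i j M _ hA hij f hi hj
    exact h
  · exact fun ω h1 h2 => avgC_of_not i j M _ hA h1 h2
  · exact fun hf => avgC_monotone p hp i j M hm _ hA hij hf
  · exact fun hf => avgC_mem_Icc p hp i j M hm _ hA hf
  · exact fun F hi hj hf => avgC_determined i j M _ hA hi hj hf


end SahiOneStep

end Summit.CriticalPhenomena.PercolationContinuityZ3.Theorems
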